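import Mathlib.LinearAlgebra.Matrix.Trace
import Mathlib.GroupTheory.Perm.Cycle.Type
import Mathlib.GroupTheory.Perm.Cycle.Factors
import HarnessLib

/-!
# Colouring sums of a permutation against a transfer matrix

For a finite set of colours `K`, a matrix `W : Matrix K K R` over a commutative ring and a
permutation `σ` of a finite type `α`, the *colouring sum*
`colouringSum W σ = ∑_{κ : α → K} ∏ᵢ W (κ i) (κ (σ i))` (all vertex colourings, weighted by the
transfer entries along the arcs `i → σ i`) factorises over the cycles of `σ`: a cycle of length
`ℓ` contributes the closed-walk sum `tr (W ^ ℓ)`, a fixed point contributes `tr W` — the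
eigenvalue-free form of `tr_{V^{⊗n}}(W^{⊗n} ∘ σ) = p_{type σ}(spec W)` (Stanley, *Enumerative
Combinatorics 2*, §7.7; Macdonald, *Symmetric Functions*, I.7). All statements are `[folklore]`:
`pinnedSum_mul_of_disjoint` (multiplicativity of the support-restricted sum over disjoint
permutations), `pinnedSum_of_isCycle` (a cycle with support `S` gives `tr (W ^ ∑_{i ∈ S} m i)`,
by contracting one vertex at a time: summing out the colour of `x` merges the arcs
`σ⁻¹ x → x → σ x` into one arc carrying `W ^ (m (σ⁻¹ x) + m x)`),
`pinnedSum_eq_prod_cycleFactors`, `colouringSum_eq_prod_cycleType` (fixed-point-free `σ`: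
`∏_{ℓ ∈ σ.cycleType} tr (W ^ ℓ)`), `colouringSum_eq_zero_of_apply_eq` (`tr W = 0` and a fixed
point kill the sum). Used by `Literature.Computability.AlgebraicComplexity.EvenCycleCoverVNP`.
Mathlib has no such statement (searched `cycleType`, `trace_pow`, `closed walk`); reused:
`Equiv.Perm.cycle_induction_on`, `support_swap_mul_eq`, `Disjoint.cycleFactorsFinset_mul_eq_union`.
-/

namespace Literature.LinearAlgebra.Matrix

open Equiv Finset

variable {α : Type*} [Fintype α] [DecidableEq α] {K : Type*} [Fintype K] [DecidableEq K]
  {R : Type*} [CommRing R]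

/-- The colouring sum of `σ` against the transfer matrix `W`:
`∑_{κ : α → K} ∏ᵢ W (κ i) (κ (σ i))`. [folklore] -/
def colouringSum (W : Matrix K K R) (σ : Perm α) : R :=
  ∑ κ : α → K, ∏ i, W (κ i) (κ (σ i))

/-- The colourings pinned to the base colour `k₀` off the support of `σ`. [folklore] -/
def pinned (k₀ : K) (σ : Perm α) : Finset (α → K) :=
  univ.filter fun κ => ∀ i, i ∉ σ.support → κ i = k₀

/-- The support-restricted colouring sum with arc multiplicities `m`: colourings pinned off the
support, the arc `i → σ i` carrying `W ^ m i`. [folklore] -/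
def pinnedSum (W : Matrix K K R) (k₀ : K) (σ : Perm α) (m : α → ℕ) : R :=
  ∑ κ ∈ pinned k₀ σ, ∏ i ∈ σ.support, (W ^ m i) (κ i) (κ (σ i))

/-- Membership in `pinned`. [folklore] -/
theorem mem_pinned {k₀ : K} {σ : Perm α} {κ : α → K} :
    κ ∈ pinned k₀ σ ↔ ∀ i, i ∉ σ.support → κ i = k₀ := by
  simp [pinned]

/-- The identity permutation: one pinned colouring, empty product. [folklore] -/
theorem pinnedSum_one (W : Matrix K K R) (k₀ : K) (m : α → ℕ) :
    pinnedSum W k₀ (1 : Perm α) m = 1 := by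
  have h : pinned k₀ (1 : Perm α) = {fun _ => k₀} := by
    ext κ
    simp only [mem_pinned, Perm.support_one, Finset.notMem_empty, not_false_eq_true,
      forall_const, Finset.mem_singleton, funext_iff]
  simp [pinnedSum, h, Perm.support_one]

/-- Restriction of a colouring to the support of `σ`, pinned to `k₀` elsewhere. [folklore] -/
def pinTo (k₀ : K) (σ : Perm α) (κ : α → K) : α → K :=
  fun i => if i ∈ σ.support then κ i else k₀

/-- `pinTo` lands in `pinned`. [folklore] -/
theorem pinTo_mem (k₀ : K) (σ : Perm α) (κ : α → K) : pinTo k₀ σ κ ∈ pinned k₀ σ := by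
  rw [mem_pinned]
  intro i hi
  simp [pinTo, hi]

/-- **Multiplicativity over disjoint permutations**: the pinned colourings of `σ * τ` are the
pairs of pinned colourings of `σ` and of `τ`, and the arc product splits over the two supports.
[folklore] -/
theorem pinnedSum_mul_of_disjoint (W : Matrix K K R) (k₀ : K) {σ τ : Perm α} (h : σ.Disjoint τ)
    (m : α → ℕ) : pinnedSum W k₀ (σ * τ) m = pinnedSum W k₀ σ m * pinnedSum W k₀ τ m := by
  have hsupp := h.support_mul
  have hdisj := h.disjoint_support
  unfold pinnedSum
  rw [Finset.sum_mul_sum, ← Finset.sum_product']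
  refine Finset.sum_nbij' (fun κ => (pinTo k₀ σ κ, pinTo k₀ τ κ))
    (fun p => fun i => if i ∈ σ.support then p.1 i else p.2 i) ?_ ?_ ?_ ?_ ?_
  · intro κ _
    exact Finset.mem_product.2 ⟨pinTo_mem _ _ _, pinTo_mem _ _ _⟩
  · rintro ⟨κ₁, κ₂⟩ hp
    rw [Finset.mem_product] at hp
    rw [mem_pinned]
    intro i hi
    rw [hsupp, Finset.mem_union, not_or] at hi
    simp only [hi.1, if_false]
    exact (mem_pinned.1 hp.2) i hi.2
  · intro κ hκ
    funext i
    by_cases hi : i ∈ σ.support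
    · simp [pinTo, hi]
    · simp only [hi, if_false, pinTo]
      by_cases hi' : i ∈ τ.support
      · simp [hi']
      · simp only [hi', if_false]
        exact ((mem_pinned.1 hκ) i (by rw [hsupp, Finset.mem_union, not_or]; exact ⟨hi, hi'⟩)).symm
  · rintro ⟨κ₁, κ₂⟩ hp
    rw [Finset.mem_product] at hp
    refine Prod.ext ?_ ?_
    · funext i
      simp only [pinTo]
      by_cases hi : i ∈ σ.support
      · simp [hi]
      · simp only [hi, if_false]
        exact ((mem_pinned.1 hp.1) i hi).symm
    · funext i
      simp only [pinTo]
      by_cases hi : i ∈ τ.support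
      · have : i ∉ σ.support := Finset.disjoint_right.1 hdisj hi
        simp [hi, this]
      · simp only [hi, if_false]
        exact ((mem_pinned.1 hp.2) i hi).symm
  · intro κ _
    rw [hsupp, Finset.prod_union hdisj]
    congr 1
    · refine Finset.prod_congr rfl fun i hi => ?_
      have hτi : τ i = i := Perm.notMem_support.1 (Finset.disjoint_left.1 hdisj hi)
      have hσi : σ i ∈ σ.support := Perm.apply_mem_support.2 hi
      simp [pinTo, hi, hσi, Perm.mul_apply, hτi]
    · refine Finset.prod_congr rfl fun i hi => ?_
      have hτi : τ i ∈ τ.support := Perm.apply_mem_support.2 hi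
      have hσ : σ (τ i) = τ i := Perm.notMem_support.1 (Finset.disjoint_right.1 hdisj hτi)
      simp [pinTo, hi, hτi, Perm.mul_apply, hσ]

/-- **A transposition** `(x y)` contributes `tr (W ^ (m x + m y))`: the two pinned colours `a, b`
of `x, y` give `∑_{a b} (W ^ m x) a b (W ^ m y) b a`. [folklore] -/
theorem pinnedSum_swap (W : Matrix K K R) (k₀ : K) {x y : α} (hxy : x ≠ y) (m : α → ℕ) :
    pinnedSum W k₀ (swap x y) m = (W ^ (m x + m y)).trace := by
  have hs : (swap x y).support = {x, y} := Perm.support_swap hxy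
  unfold pinnedSum
  rw [hs, pow_add, Matrix.trace]
  simp only [Matrix.diag_apply, Matrix.mul_apply]
  rw [← Finset.sum_product' (f := fun a b => (W ^ m x) a b * (W ^ m y) b a), Finset.univ_product_univ]
  symm
  refine Finset.sum_nbij' (fun p => fun i => if i = x then p.1 else if i = y then p.2 else k₀)
    (fun κ => (κ x, κ y)) ?_ ?_ ?_ ?_ ?_
  · intro p _
    rw [mem_pinned]
    intro i hi
    rw [hs, Finset.mem_insert, Finset.mem_singleton, not_or] at hi
    simp [hi.1, hi.2]
  · intro κ _
    exact Finset.mem_univ _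
  · rintro ⟨a, b⟩ _
    simp [hxy.symm]
  · intro κ hκ
    funext i
    by_cases hix : i = x
    · simp [hix]
    · by_cases hiy : i = y
      · simp [hiy, hxy.symm]
      · simp only [hix, hiy, if_false]
        refine ((mem_pinned.1 hκ) i ?_).symm
        rw [hs, Finset.mem_insert, Finset.mem_singleton, not_or]
        exact ⟨hix, hiy⟩
  · rintro ⟨a, b⟩ _
    rw [Finset.prod_pair hxy]
    simp [swap_apply_left, swap_apply_right, hxy.symm]

/-- **Contraction of a vertex.** If `x`, `σ x`, `σ⁻¹ x` are pairwise distinct, summing out the colour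
of `x` merges the arcs `σ⁻¹ x → x` and `x → σ x` into the single arc `σ⁻¹ x → σ x` of
`swap x (σ x) * σ`, carrying `W ^ (m (σ⁻¹ x) + m x)`. [folklore] -/
theorem pinnedSum_contract (W : Matrix K K R) (k₀ : K) {σ : Perm α} {x : α} (hx : σ x ≠ x)
    (hxx : σ (σ x) ≠ x) (m : α → ℕ) :
    pinnedSum W k₀ σ m = pinnedSum W k₀ (swap x (σ x) * σ)
      (Function.update m (σ⁻¹ x) (m (σ⁻¹ x) + m x)) := by
  set τ : Perm α := swap x (σ x) * σ with hτ
  set z : α := σ⁻¹ x with hz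
  have hσz : σ z = x := by simp [hz]
  have hzx : z ≠ x := by
    intro h; apply hx; rw [← h, hσz, h]
  have hzy : z ≠ σ x := by
    intro h; apply hxx; rw [← h, hσz]
  have hxmem : x ∈ σ.support := Perm.mem_support.2 hx
  have hzmem : z ∈ σ.support := Perm.mem_support.2 (by rw [hσz]; exact hzx.symm)
  have hsuppτ : τ.support = σ.support \ {x} := Perm.support_swap_mul_eq σ x hxx
  have hxτ : x ∉ τ.support := by simp [hsuppτ]
  have hzτ : z ∈ τ.support := by simp [hsuppτ, hzmem, hzx]
  have hτz : τ z = σ x := by simp [hτ, Perm.mul_apply, hσz, swap_apply_left]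
  have hτi : ∀ i, i ≠ x → i ≠ z → τ i = σ i := by
    intro i hix hiz
    simp only [hτ, Perm.mul_apply]
    refine swap_apply_of_ne_of_ne ?_ ?_
    · intro h; apply hiz; rw [hz, Perm.eq_inv_iff_eq]; exact h
    · intro h; exact hix (σ.injective h)
  -- the set `rest = supp τ \ {z} = supp σ \ {x} \ {z}`
  set rest : Finset α := τ.support \ {z} with hrest
  have hsuppτ' : τ.support = insert z rest := by
    rw [hrest, Finset.insert_eq, Finset.union_sdiff_of_subset (Finset.singleton_subset_iff.2 hzτ)]
  have hsuppσ' : σ.support = insert x (insert z rest) := by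
    rw [← hsuppτ', hsuppτ, Finset.insert_eq,
      Finset.union_sdiff_of_subset (Finset.singleton_subset_iff.2 hxmem)]
  have hx_notin : x ∉ insert z rest := by
    rw [← hsuppτ']; exact hxτ
  have hz_notin : z ∉ rest := by simp [hrest]
  have hrest_ne : ∀ i ∈ rest, i ≠ x ∧ i ≠ z := by
    intro i hi
    refine ⟨?_, ?_⟩
    · rintro rfl; exact hx_notin (Finset.mem_insert_of_mem hi)
    · rintro rfl; exact hz_notin hi
  -- Step 1: reindex the pinned colourings of `σ` as (colour of `x`, pinned colouring of `τ`).
  unfold pinnedSum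
  have step1 : ∑ κ ∈ pinned k₀ σ, ∏ i ∈ σ.support, (W ^ m i) (κ i) (κ (σ i)) =
      ∑ p ∈ (univ : Finset K) ×ˢ pinned k₀ τ,
        ∏ i ∈ σ.support, (W ^ m i) (Function.update p.2 x p.1 i)
          (Function.update p.2 x p.1 (σ i)) := by
    refine Finset.sum_nbij' (fun κ => (κ x, Function.update κ x k₀))
      (fun p => Function.update p.2 x p.1) ?_ ?_ ?_ ?_ ?_
    · intro κ hκ
      refine Finset.mem_product.2 ⟨Finset.mem_univ _, mem_pinned.2 fun i hi => ?_⟩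
      by_cases hix : i = x
      · subst hix; simp
      · show Function.update κ x k₀ i = k₀
        rw [Function.update_of_ne hix]
        refine (mem_pinned.1 hκ) i ?_
        rw [hsuppτ, Finset.mem_sdiff, not_and_or] at hi
        rcases hi with hi | hi
        · exact hi
        · exact absurd (Finset.mem_singleton.1 (not_not.1 hi)) hix
    · rintro ⟨a, κ'⟩ hp
      rw [Finset.mem_product] at hp
      refine mem_pinned.2 fun i hi => ?_
      have hix : i ≠ x := by rintro rfl; exact hi hxmem
      rw [Function.update_of_ne hix]
      refine (mem_pinned.1 hp.2) i ?_
      rw [hsuppτ, Finset.mem_sdiff, not_and_or]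
      exact Or.inl hi
    · intro κ _
      simp
    · rintro ⟨a, κ'⟩ hp
      rw [Finset.mem_product] at hp
      have hκx : κ' x = k₀ := (mem_pinned.1 hp.2) x hxτ
      refine Prod.ext (by simp) ?_
      simp only [Function.update_idem]
      rw [← hκx, Function.update_eq_self]
    · intro κ _
      simp
  rw [step1, Finset.sum_product_right]
  refine Finset.sum_congr rfl fun κ' hκ' => ?_
  -- Step 2: for a pinned colouring `κ'` of `τ`, sum out the colour `a` of `x`.
  have inner : ∀ a : K, ∏ i ∈ σ.support, (W ^ m i) (Function.update κ' x a i)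
      (Function.update κ' x a (σ i)) =
      ((W ^ m z) (κ' z) a * (W ^ m x) a (κ' (σ x))) *
        ∏ i ∈ rest, (W ^ m i) (κ' i) (κ' (σ i)) := by
    intro a
    rw [hsuppσ', Finset.prod_insert hx_notin, Finset.prod_insert hz_notin]
    have h1 : Function.update κ' x a (σ x) = κ' (σ x) := Function.update_of_ne hx _ _
    have h2 : Function.update κ' x a z = κ' z := Function.update_of_ne hzx _ _
    rw [Function.update_self, h1, hσz, h2, Function.update_self]
    have h3 : ∏ i ∈ rest, (W ^ m i) (Function.update κ' x a i) (Function.update κ' x a (σ i)) =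
        ∏ i ∈ rest, (W ^ m i) (κ' i) (κ' (σ i)) := by
      refine Finset.prod_congr rfl fun i hi => ?_
      obtain ⟨hix, hiz⟩ := hrest_ne i hi
      have hσix : σ i ≠ x := by
        intro h; apply hiz; rw [hz, Perm.eq_inv_iff_eq]; exact h
      rw [Function.update_of_ne hix, Function.update_of_ne hσix]
    rw [h3]
    ring
  simp only [inner]
  rw [← Finset.sum_mul]
  have h4 : ∑ a : K, (W ^ m z) (κ' z) a * (W ^ m x) a (κ' (σ x)) =
      (W ^ (m z + m x)) (κ' z) (κ' (σ x)) := by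
    rw [pow_add, Matrix.mul_apply]
  rw [h4, hsuppτ', Finset.prod_insert hz_notin, Function.update_self, hτz]
  congr 1
  refine Finset.prod_congr rfl fun i hi => ?_
  obtain ⟨hix, hiz⟩ := hrest_ne i hi
  rw [Function.update_of_ne hiz, hτi i hix hiz]

/-- **A cycle** with support `S` contributes `tr (W ^ ∑_{i ∈ S} m i)` (induction on `#S` by
contraction; a `2`-cycle is `pinnedSum_swap`). [folklore] -/
theorem pinnedSum_of_isCycle (W : Matrix K K R) (k₀ : K) :
    ∀ (n : ℕ) (σ : Perm α), σ.IsCycle → σ.support.card ≤ n → ∀ m : α → ℕ,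
      pinnedSum W k₀ σ m = (W ^ (∑ i ∈ σ.support, m i)).trace := by
  intro n
  induction n with
  | zero =>
    intro σ hσ hcard
    have := hσ.two_le_card_support
    omega
  | succ n ih =>
    intro σ hσ hcard m
    obtain ⟨x, hx, -⟩ := id hσ
    by_cases hxx : σ (σ x) = x
    · have hswap : σ = swap x (σ x) := hσ.eq_swap_of_apply_apply_eq_self hx hxx
      have hne : x ≠ σ x := fun h => hx h.symm
      rw [hswap, pinnedSum_swap W k₀ hne, Perm.support_swap hne, Finset.sum_pair hne]
    · rw [pinnedSum_contract W k₀ hx hxx m]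
      have hlt := Perm.card_support_swap_mul hx
      have hcyc : (swap x (σ x) * σ).IsCycle := hσ.swap_mul hx hxx
      rw [ih _ hcyc (by omega)]
      congr 2
      have hsupp : (swap x (σ x) * σ).support = σ.support \ {x} := Perm.support_swap_mul_eq σ x hxx
      have hzx : σ⁻¹ x ≠ x := by
        intro h
        apply hx
        calc σ x = σ (σ⁻¹ x) := by rw [h]
          _ = x := σ.apply_symm_apply x
      have hz' : σ⁻¹ x ∈ σ.support.erase x := by
        rw [Finset.mem_erase, Perm.mem_support, show σ (σ⁻¹ x) = x from σ.apply_symm_apply x]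
        exact ⟨hzx, hzx.symm⟩
      have hz : σ⁻¹ x ∈ (swap x (σ x) * σ).support := by
        rw [hsupp, Finset.sdiff_singleton_eq_erase]; exact hz'
      have hxmem : x ∈ σ.support := Perm.mem_support.2 hx
      rw [Finset.sum_update_of_mem hz, hsupp, Finset.sdiff_singleton_eq_erase,
        Finset.sdiff_singleton_eq_erase, ← Finset.add_sum_erase _ _ hxmem,
        ← Finset.add_sum_erase _ _ hz']
      ring

/-- **Product formula**: the pinned colouring sum of `σ` is the product over the cycles `c` of `σ`
of `tr (W ^ ∑_{i ∈ supp c} m i)` (`Equiv.Perm.cycle_induction_on`). [folklore] -/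
theorem pinnedSum_eq_prod_cycleFactors (W : Matrix K K R) (k₀ : K) (σ : Perm α) (m : α → ℕ) :
    pinnedSum W k₀ σ m = ∏ c ∈ σ.cycleFactorsFinset, (W ^ (∑ i ∈ c.support, m i)).trace := by
  induction σ using Perm.cycle_induction_on with
  | base_one => rw [pinnedSum_one, Perm.cycleFactorsFinset_one, Finset.prod_empty]
  | base_cycles σ hσ =>
    rw [hσ.cycleFactorsFinset_eq_singleton, Finset.prod_singleton,
      pinnedSum_of_isCycle W k₀ _ σ hσ le_rfl m]
  | induction_disjoint σ τ hd _ ihσ ihτ =>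
    rw [pinnedSum_mul_of_disjoint W k₀ hd, ihσ, ihτ, hd.cycleFactorsFinset_mul_eq_union,
      Finset.prod_union hd.disjoint_cycleFactorsFinset]

/-- **Cycle-type formula**: for a fixed-point-free permutation `σ`,
`∑_κ ∏ᵢ W (κ i) (κ (σ i)) = ∏_{ℓ ∈ cycleType σ} tr (W ^ ℓ)` (the power-sum symmetric function
`p_{type σ}` at the eigenvalues of `W`). [folklore] -/
theorem colouringSum_eq_prod_cycleType (W : Matrix K K R) {σ : Perm α}
    (hσ : σ.support = Finset.univ) :
    colouringSum W σ = (σ.cycleType.map fun ℓ => (W ^ ℓ).trace).prod := by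
  rcases isEmpty_or_nonempty K with hK | ⟨⟨k₀⟩⟩
  · rcases isEmpty_or_nonempty α with hα | ⟨⟨x⟩⟩
    · have h1 : σ = 1 := Subsingleton.elim _ _
      subst h1
      simp [colouringSum, Perm.cycleType_one]
    · have hL : colouringSum W σ = 0 := by
        unfold colouringSum
        haveI : IsEmpty (α → K) := ⟨fun κ => hK.false (κ x)⟩
        exact Fintype.sum_empty _
      have hx : x ∈ σ.support := hσ ▸ Finset.mem_univ x
      have hne : σ.cycleType ≠ 0 := by
        intro h0
        rw [Perm.cycleType_eq_zero] at h0
        subst h0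
        simp at hx
      obtain ⟨ℓ, hℓ⟩ := Multiset.exists_mem_of_ne_zero hne
      rw [hL, eq_comm]
      apply Multiset.prod_eq_zero
      rw [Multiset.mem_map]
      exact ⟨ℓ, hℓ, by simp [Matrix.trace]⟩
  · have h1 : colouringSum W σ = pinnedSum W k₀ σ (fun _ => 1) := by
      unfold colouringSum pinnedSum
      have hp : pinned k₀ σ = univ := by
        refine Finset.filter_true_of_mem fun κ _ i hi => ?_
        rw [hσ] at hi
        exact absurd (Finset.mem_univ i) hi
      rw [hp, hσ]
      simp only [pow_one]
    rw [h1, pinnedSum_eq_prod_cycleFactors, Perm.cycleType_def, Multiset.map_map,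
      Finset.prod_map_val]
    refine Finset.prod_congr rfl fun c _ => ?_
    simp only [Function.comp_apply, Finset.sum_const, smul_eq_mul, mul_one]

omit [DecidableEq K] in
/-- **A fixed point kills the sum when `tr W = 0`**: the colour of a fixed point `x` enters only
through the factor `W (κ x) (κ x)`, which sums to `tr W`. [folklore] -/
theorem colouringSum_eq_zero_of_apply_eq (W : Matrix K K R) (hW : W.trace = 0) {σ : Perm α}
    {x : α} (hx : σ x = x) : colouringSum W σ = 0 := by
  rcases isEmpty_or_nonempty K with hK | ⟨⟨a₀⟩⟩
  · unfold colouringSum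
    haveI : IsEmpty (α → K) := ⟨fun κ => hK.false (κ x)⟩
    exact Fintype.sum_empty _
  unfold colouringSum
  rw [← (Equiv.funSplitAt x K).symm.sum_comp, Fintype.sum_prod_type, Finset.sum_comm]
  refine Finset.sum_eq_zero fun g _ => ?_
  have key : ∀ a : K, ∏ i, W ((Equiv.funSplitAt x K).symm (a, g) i)
      ((Equiv.funSplitAt x K).symm (a, g) (σ i)) =
      W a a * ∏ i ∈ ({x}ᶜ : Finset α), W ((Equiv.funSplitAt x K).symm (a, g) i)
        ((Equiv.funSplitAt x K).symm (a, g) (σ i)) := by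
    intro a
    rw [Fintype.prod_eq_mul_prod_compl x]
    simp [hx]
  have indep : ∀ a : K, ∏ i ∈ ({x}ᶜ : Finset α), W ((Equiv.funSplitAt x K).symm (a, g) i)
        ((Equiv.funSplitAt x K).symm (a, g) (σ i)) =
      ∏ i ∈ ({x}ᶜ : Finset α), W ((Equiv.funSplitAt x K).symm (a₀, g) i)
        ((Equiv.funSplitAt x K).symm (a₀, g) (σ i)) := by
    intro a
    refine Finset.prod_congr rfl fun i hi => ?_
    have hix : i ≠ x := by simpa using hi
    have hσix : σ i ≠ x := fun h => hix (σ.injective (h.trans hx.symm))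
    simp [Equiv.funSplitAt_symm_apply, hix, hσix]
  simp only [key, indep, ← Finset.sum_mul]
  have htr : ∑ a : K, W a a = W.trace := rfl
  rw [htr, hW, zero_mul]

end Literature.LinearAlgebra.Matrix
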